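import Literature.NumberTheory.IwasawaTheory.ClassicalMuVanishesNonsplitCartanFiveImage
import Literature.NumberTheory.IwasawaTheory.ClassicalMuVanishesDivisionFieldThree
import HarnessLib

set_option autoImplicit false

/-!
# `μ = 0` for `ℚ(E[5])_cyc` (the hypothesis of the class-group road to Coates–Sujatha (A) at `p = 5`) for elliptic curves whose
# mod-5 image is the normaliser of a non-split Cartan subgroup, from `μ = 0` of seven explicit subfields — fact-free

Topic `NumberTheory/IwasawaTheory` (namespace = path).  THEOREM-ONLY file (no definition, no named fact, no `sorry`); literature seat
`bsd-potss-conjA-anchor` g12 (supports stmt-BirchSwinnertonDyer-19413: the KT rows with image `N_ns(5)` (LMFDB `5Nn`); closes nothing).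
The `ℚ(E[5])`-level form of `ClassicalMuVanishesNonsplitCartanFiveImage`, parallel to the split-Cartan file
`ClassicalMuVanishesDivisionFieldFive` (g11): the representation is the tree's own `exists_matrixRep_divisionField` in a basis `e` of
`E[5]` in which `Γ_ℚ` acts through `nonsplitCartanNormalizer ε` (`ε ∈ 𝔽₅` a non-square) — the body of
`HasModPImageEqNonsplitCartanNormalizer E 5` with the basis exposed, because the two elements `σ_x, σ_s ∈ Γ_ℚ` are specified by their
matrices `R_ε = (1 ε(4−ε); 4−ε 1)` (a generator of `C_ns(ε) ≅ 𝔽₂₅ˣ`) and `S = diag(1, −1)` in THAT basis; when the image is all of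
`C_ns⁺(ε)` they exist (`exists_nonsplitCartanBasis_of_hasModPImageEqNonsplitCartanNormalizer_five`).  Inputs: «`μ = 0` for every
cyclotomic `ℤ_5`-extension» of the fixed fields in `ℚ(E[5])` of `⟨σ̄_s⟩` (`= ℚ(P₁)`, `P₁ = e⁻¹(1,0)`, degree 24), `⟨σ̄_x¹², σ̄_s⟩`
(degree 12), `⟨σ̄_x⁶ σ̄_s⟩` (12), `⟨σ̄_x³⟩` (6, the `S₃`-sextic `ℚ(E[5])^{C₈}`), `⟨σ̄_x⁶, σ̄_s⟩` (6), `⟨σ̄_x⁶, σ̄_x³σ̄_s⟩` (6), `⟨σ̄_x³, σ̄_s⟩`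
(3, a non-Galois cubic), where `σ̄ = σ|_{ℚ(E[5])}` (`absRestrictNormalHom`); output: «`μ = 0` for every cyclotomic `ℤ_5`-extension of
`ℚ(E[5])`» — verbatim the hypothesis of `CoatesSujatha2005.thm34_fineSelmerDual_moduleFinite_of_classicalMuVanishes_divisionField` at
`p = 5`.  NO named fact is used (no growth theorem, no Ferrero–Washington): eleven Kuroda equalities (`ClassicalMuVanishesNonsplitCartanFiveDescent`).

References: [Serre1972, §2.2]; [FurioLombardo2023, (1.1), Thm. 1.5]; [Lemmermeyer1994, §1]; [Washington1997, §13.1]; [SilvermanAEC2009, III.§7].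
-/

noncomputable section

open scoped NumberField Matrix

open Field IntermediateField WeierstrassCurve Literature.NumberTheory.EllipticCurves Literature.NumberTheory.GaloisRepresentations
  Literature.NumberTheory.SerreUniformity

namespace Literature.NumberTheory.IwasawaTheory

/-- `Γ_ℚ → Gal(ℚ(E[n])/ℚ)` is onto. [folklore] -/
private theorem absRestrictNormalHom_surjective_dF₅ₙ {F : Type*} [Field F] (E : IntermediateField F (AlgebraicClosure F))
    [Normal F E] : Function.Surjective (absRestrictNormalHom E) := fun g => by
  obtain ⟨σ, hσ⟩ := AlgEquiv.restrictNormalHom_surjective (AlgebraicClosure F) g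
  exact ⟨(absoluteGaloisGroup.toAlgEquiv F).symm σ, hσ⟩

/-- Two matrices with the same action on the vectors `e P` are equal. [folklore] -/
private theorem matrix_eq_of_forall_mulVec₅ₙ {A : Type*} [AddCommGroup A] {n : ℕ} (e : A ≃+ (Fin 2 → ZMod n))
    {M N : Matrix (Fin 2) (Fin 2) (ZMod n)} (h : ∀ P : A, M *ᵥ e P = N *ᵥ e P) : M = N :=
  Matrix.toLin'.injective (LinearMap.ext fun v => by
    rw [Matrix.toLin'_apply, Matrix.toLin'_apply, ← e.apply_symm_apply v, h])

/-- The two named matrices lie in `C_ns⁺(ε)`: `R_ε = (1 ε(4−ε); 4−ε 1) ∈ C_ns(ε)` (`a = 1`, `b = 4 − ε`) and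
`S = diag(1, 4) = diag(1, −1)` in the other coset (`a = 1`, `b = 0`). [cite: FurioLombardo2023, (1.1)] -/
theorem generator_mem_nonsplitCartanNormalizer_five (ε : ZMod 5) :
    !![1, ε * (4 - ε); 4 - ε, 1] ∈ nonsplitCartanNormalizer ε ∧ !![1, 0; 0, 4] ∈ nonsplitCartanNormalizer ε :=
  ⟨⟨1, 4 - ε, by revert ε; decide, Or.inl rfl⟩,
    ⟨1, 0, by decide, Or.inr (by rw [mul_zero, neg_zero]; decide)⟩⟩

/-- **From the predicate to the data.**  If the mod-5 image of `W` is (exactly) the normaliser of a non-split Cartan subgroup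
(`HasModPImageEqNonsplitCartanNormalizer W 5`), then there are a basis `e` of `E[5]`, a non-square `ε`, and `σ_x, σ_s ∈ Γ_ℚ` acting in the
basis `e` as `R_ε = (1 ε(4−ε); 4−ε 1)` and `S = diag(1, −1)`, every `σ ∈ Γ_ℚ` acting through `C_ns⁺(ε)` — the input shape of
`classicalMuVanishes_divisionField_of_nonsplitCartanBasis_five` below. [cite: FurioLombardo2023, Thm. 1.5 (second alternative)] -/
theorem exists_nonsplitCartanBasis_of_hasModPImageEqNonsplitCartanNormalizer_five (W : WeierstrassCurve ℚ)
    (h : HasModPImageEqNonsplitCartanNormalizer W 5) :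
    ∃ (e : W.geomTorsion (5 : ℕ) ≃+ (Fin 2 → ZMod 5)) (ε : ZMod 5), ¬ IsSquare ε ∧
      (∀ σ : absoluteGaloisGroup ℚ, ∃ M ∈ nonsplitCartanNormalizer ε, ∀ P : W.geomTorsion (5 : ℕ), e (σ • P) = M *ᵥ e P) ∧
      ∃ σx σs : absoluteGaloisGroup ℚ, (∀ P : W.geomTorsion (5 : ℕ), e (σx • P) = !![1, ε * (4 - ε); 4 - ε, 1] *ᵥ e P) ∧
        (∀ P : W.geomTorsion (5 : ℕ), e (σs • P) = !![1, 0; 0, 4] *ᵥ e P) := by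
  obtain ⟨e, ε, hε, himg, hsurj⟩ := h
  obtain ⟨hR, hS⟩ := generator_mem_nonsplitCartanNormalizer_five ε
  obtain ⟨σx, hσx⟩ := hsurj _ hR
  obtain ⟨σs, hσs⟩ := hsurj _ hS
  exact ⟨e, ε, hε, himg, σx, σs, hσx, hσs⟩

/-- `…_nonsplitCartanNormalizer_five_fixedField` for any `ℚ`-algebra structure on `L` (all coincide: `Subsingleton (Algebra ℚ L)`).
[cite: Serre1972, §2.2 (non-split Cartan subgroups, normalisers)] [cite: Washington1997, §13.1] -/
private theorem nonsplit_five_fixedField_alg [Fact (Nat.Prime 5)]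
    (L : Type) [Field L] [NumberField L] [alg : Algebra ℚ L] [IsGalois ℚ L] {ε : ZMod 5} (hε : ¬ IsSquare ε)
    (ρ : (L ≃ₐ[ℚ] L) →* Matrix (Fin 2) (Fin 2) (ZMod 5)) (hρ : Function.Injective ρ)
    (himg : ∀ g, ρ g ∈ nonsplitCartanNormalizer ε) {x s : L ≃ₐ[ℚ] L}
    (hρx : ρ x = !![1, ε * (4 - ε); 4 - ε, 1]) (hρs : ρ s = !![1, 0; 0, 4])
    (hμP : ∀ κE : ZpExtension ↥(fixedField (Subgroup.zpowers s)) 5, κE.IsCyclotomic → ClassicalMuVanishes κE)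
    (hμB₁ : ∀ κE : ZpExtension ↥(fixedField (Subgroup.zpowers (x ^ 12) ⊔ Subgroup.zpowers s)) 5,
      κE.IsCyclotomic → ClassicalMuVanishes κE)
    (hμB₁' : ∀ κE : ZpExtension ↥(fixedField (Subgroup.zpowers (x ^ 6 * s))) 5, κE.IsCyclotomic → ClassicalMuVanishes κE)
    (hμS : ∀ κE : ZpExtension ↥(fixedField (Subgroup.zpowers (x ^ 3))) 5, κE.IsCyclotomic → ClassicalMuVanishes κE)
    (hμB₂ : ∀ κE : ZpExtension ↥(fixedField (Subgroup.zpowers (x ^ 6) ⊔ Subgroup.zpowers s)) 5,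
      κE.IsCyclotomic → ClassicalMuVanishes κE)
    (hμB₂' : ∀ κE : ZpExtension ↥(fixedField (Subgroup.zpowers (x ^ 6) ⊔ Subgroup.zpowers (x ^ 3 * s))) 5,
      κE.IsCyclotomic → ClassicalMuVanishes κE)
    (hμB₃ : ∀ κE : ZpExtension ↥(fixedField (Subgroup.zpowers (x ^ 3) ⊔ Subgroup.zpowers s)) 5,
      κE.IsCyclotomic → ClassicalMuVanishes κE)
    (κL : ZpExtension L 5) (hκL : κL.IsCyclotomic) : ClassicalMuVanishes κL := by
  have h : alg = DivisionRing.toRatAlgebra := Subsingleton.elim _ _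
  subst h
  exact classicalMuVanishes_of_isCyclotomic_of_nonsplitCartanNormalizer_five_fixedField L hε ρ hρ himg hρx hρs hμP hμB₁ hμB₁' hμS
    hμB₂ hμB₂' hμB₃ κL hκL

/-- **`μ = 0` for `ℚ(E[5])_cyc` from a non-split-Cartan-normaliser mod-5 image — fact-free.**  `E/ℚ` elliptic; `e` a basis of `E[5]`
and `ε ∈ 𝔽₅` a non-square such that every `σ ∈ Γ_ℚ` acts through `nonsplitCartanNormalizer ε`; `σ_x, σ_s ∈ Γ_ℚ` acting in the basis
`e` as `R_ε = (1 ε(4−ε); 4−ε 1)` and `S = diag(1, −1)` (they exist when the image is all of `C_ns⁺(ε)`,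
`exists_nonsplitCartanBasis_of_hasModPImageEqNonsplitCartanNormalizer_five`).  If `μ = 0` holds for every cyclotomic `ℤ_5`-extension
of the fixed fields in `ℚ(E[5])` of `⟨σ̄_s⟩` (`= ℚ(P₁)`, degree 24), `⟨σ̄_x¹², σ̄_s⟩` (12), `⟨σ̄_x⁶σ̄_s⟩` (12), `⟨σ̄_x³⟩` (6),
`⟨σ̄_x⁶, σ̄_s⟩` (6), `⟨σ̄_x⁶, σ̄_x³σ̄_s⟩` (6), `⟨σ̄_x³, σ̄_s⟩` (3), then for every cyclotomic `ℤ_5`-extension of `ℚ(E[5])`: the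
hypothesis of road (b) (`CoatesSujatha2005.thm34_…`) at `p = 5`.  No growth theorem, no Ferrero–Washington; eleven Kuroda equalities.
[cite: Serre1972, §2.2 (non-split Cartan subgroups, normalisers)] [cite: Lemmermeyer1994, §1 (Kuroda's class number formula, odd part)]
[cite: Washington1997, §13.1] -/
theorem classicalMuVanishes_divisionField_of_nonsplitCartanBasis_five [Fact (Nat.Prime 5)] (W : WeierstrassCurve ℚ) [W.IsElliptic]
    (e : W.geomTorsion (5 : ℕ) ≃+ (Fin 2 → ZMod 5)) {ε : ZMod 5} (hε : ¬ IsSquare ε)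
    (he : ∀ σ : absoluteGaloisGroup ℚ, ∃ M ∈ nonsplitCartanNormalizer ε, ∀ P : W.geomTorsion (5 : ℕ), e (σ • P) = M *ᵥ e P)
    (σx σs : absoluteGaloisGroup ℚ) (hσx : ∀ P : W.geomTorsion (5 : ℕ), e (σx • P) = !![1, ε * (4 - ε); 4 - ε, 1] *ᵥ e P)
    (hσs : ∀ P : W.geomTorsion (5 : ℕ), e (σs • P) = !![1, 0; 0, 4] *ᵥ e P)
    (hμP : haveI : NumberField ↥(W.divisionField 5) := NumberField.mk
      ∀ κE : ZpExtension ↥(fixedField (Subgroup.zpowers (absRestrictNormalHom (W.divisionField 5) σs))) 5,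
        κE.IsCyclotomic → ClassicalMuVanishes κE)
    (hμB₁ : haveI : NumberField ↥(W.divisionField 5) := NumberField.mk
      ∀ κE : ZpExtension ↥(fixedField (Subgroup.zpowers (absRestrictNormalHom (W.divisionField 5) σx ^ 12) ⊔
        Subgroup.zpowers (absRestrictNormalHom (W.divisionField 5) σs))) 5,
        κE.IsCyclotomic → ClassicalMuVanishes κE)
    (hμB₁' : haveI : NumberField ↥(W.divisionField 5) := NumberField.mk
      ∀ κE : ZpExtension ↥(fixedField (Subgroup.zpowers (absRestrictNormalHom (W.divisionField 5) σx ^ 6 *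
        absRestrictNormalHom (W.divisionField 5) σs))) 5,
        κE.IsCyclotomic → ClassicalMuVanishes κE)
    (hμS : haveI : NumberField ↥(W.divisionField 5) := NumberField.mk
      ∀ κE : ZpExtension ↥(fixedField (Subgroup.zpowers (absRestrictNormalHom (W.divisionField 5) σx ^ 3))) 5,
        κE.IsCyclotomic → ClassicalMuVanishes κE)
    (hμB₂ : haveI : NumberField ↥(W.divisionField 5) := NumberField.mk
      ∀ κE : ZpExtension ↥(fixedField (Subgroup.zpowers (absRestrictNormalHom (W.divisionField 5) σx ^ 6) ⊔
        Subgroup.zpowers (absRestrictNormalHom (W.divisionField 5) σs))) 5,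
        κE.IsCyclotomic → ClassicalMuVanishes κE)
    (hμB₂' : haveI : NumberField ↥(W.divisionField 5) := NumberField.mk
      ∀ κE : ZpExtension ↥(fixedField (Subgroup.zpowers (absRestrictNormalHom (W.divisionField 5) σx ^ 6) ⊔
        Subgroup.zpowers (absRestrictNormalHom (W.divisionField 5) σx ^ 3 * absRestrictNormalHom (W.divisionField 5) σs))) 5,
        κE.IsCyclotomic → ClassicalMuVanishes κE)
    (hμB₃ : haveI : NumberField ↥(W.divisionField 5) := NumberField.mk
      ∀ κE : ZpExtension ↥(fixedField (Subgroup.zpowers (absRestrictNormalHom (W.divisionField 5) σx ^ 3) ⊔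
        Subgroup.zpowers (absRestrictNormalHom (W.divisionField 5) σs))) 5,
        κE.IsCyclotomic → ClassicalMuVanishes κE) :
    haveI : NumberField ↥(W.divisionField 5) := NumberField.mk
    ∀ κL : ZpExtension ↥(W.divisionField 5) 5, κL.IsCyclotomic → ClassicalMuVanishes κL := by
  haveI : NumberField ↥(W.divisionField 5) := NumberField.mk
  intro κL hκL
  obtain ⟨ρ, hρ, hρe⟩ := exists_matrixRep_divisionField W 5 e
  have hπ := absRestrictNormalHom_surjective_dF₅ₙ (W.divisionField 5)
  have hmat : ∀ (σ : absoluteGaloisGroup ℚ) (M : Matrix (Fin 2) (Fin 2) (ZMod 5)),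
      (∀ P : W.geomTorsion (5 : ℕ), e (σ • P) = M *ᵥ e P) → ρ (absRestrictNormalHom (W.divisionField 5) σ) = M :=
    fun σ M hM => matrix_eq_of_forall_mulVec₅ₙ e fun P => by rw [← hρe, hM]
  have himg' : ∀ g, ρ g ∈ nonsplitCartanNormalizer ε := fun g => by
    obtain ⟨σ, rfl⟩ := hπ g
    obtain ⟨M, hM, hMe⟩ := he σ
    rw [hmat σ M hMe]
    exact hM
  exact @nonsplit_five_fixedField_alg _ ↥(W.divisionField 5) _ _ (_) (W.isGalois_divisionField 5) ε hε ρ hρ himg' _ _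
    (hmat σx _ hσx) (hmat σs _ hσs) hμP hμB₁ hμB₁' hμS hμB₂ hμB₂' hμB₃ κL hκL

end Literature.NumberTheory.IwasawaTheory

end
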